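import Mathlib.Analysis.SpecialFunctions.Sqrt
import Mathlib.Analysis.SpecialFunctions.Pow.Deriv
import Literature.Analysis.FluidPDE.SelfSimilar
import Literature.Analysis.FluidPDE.WholeSpaceIBP
import HarnessLib

/-!
# Calculus of Leray's backward (and forward) self-similar fields (chain rule for `u = λ(t) U(λ(t) x)`)

Analysis/FluidPDE proofs-layer file (theorems only) over the accepted definitions
`lerayBackward a T U t x = λ(t) U(λ(t) x)`, `λ(t) = (2a(T − t))^{-1/2}`, and `IsLerayProfile`
(`SelfSimilar.lean`; Leray 1934, (3.11)–(3.12); Tsai 1998, (1.2)–(1.3)). It serves the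
decomposition of the named fact `Literature.Analysis.FluidPDE.tsai1998_lemma41`
(`TsaiLocalEnergy`; Tsai 1998, Lemma 4.1), whose proof uses that the self-similar field of a
profile is a classical solution of Navier–Stokes below the blow-up time with the pressure
`p = λ² P̃(λx)` (Tsai 1998, p. 46: "Now we can define `p` by (1.2)₂. Clearly `p` together with
`u` satisfy (1.1)").

## Contents (all proved; `E` a finite-dimensional real inner product space)

* dilation calculus `x ↦ k • U(c x)`: `fderiv_const_smul_comp_smul'`, `fderiv_smul_comp_smul`,
  `laplacian_smul_comp_smul` (`Δ(cU(c·)) = c³ (ΔU)(c·)`), `divergence_smul_comp_smul`,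
  `convect_smul_comp_smul`, `gradient_sq_mul_comp_smul_sub`;
* the scale factor: `lerayScale_pos`, `lerayScale_sq`, **`hasDerivAt_lerayScale`** (`λ' = aλ³`),
  `contDiffOn_lerayScale` (smooth on `(-∞, T)`);
* slices of `u = lerayBackward a T U`: `fderiv_lerayBackward` (`Du(t) = λ² DU(λ·)`),
  `laplacian_lerayBackward` (`λ³`), `convect_lerayBackward` (`λ³`), `divergence_lerayBackward`
  (`λ²`), `isDivFree_lerayBackward`; the time line `hasDerivAt_lerayBackward_time` /
  `timeDeriv_lerayBackward` (`∂ₜu = aλ³ (U + (y·∇)U)(λx)`); the pressure slice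
  `gradient_lerayBackwardPressure_sub` (`∇(λ²(P(λ·) − k)) = λ³ (∇P)(λ·)`);
* **`IsLerayProfile.momentum_lerayBackward`**: for a profile `(U, P)` and any constant `k`,
  `∂ₜu + (u·∇)u = νΔu − ∇p` pointwise on `{t < T} × E` with `p = λ²(P(λx) − k)` (Leray's
  reduction (3.11)–(3.12), backward direction; the constant `k` is the pressure gauge used in
  Tsai's Lemma 4.1);
* joint regularity on the open slab: `contDiffOn_uncurry_lerayBackward`,
  `contDiffOn_uncurry_lerayBackwardPressure_sub`, `continuousOn_uncurry_lerayBackward`;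
* **`lerayBackward_isClassical_iff_holds`**, the discharge of the named fact
  `lerayBackward_isClassical_iff` of `SelfSimilar.lean` (the same reduction for `C^∞` profiles, as
  an `iff` with `IsClassicalNSSolutionOn (Iio T)`; Leray 1934, §20, p. 225): on the open time set
  `Iio T` the one-sided `timeDerivWithin` is the two-sided `timeDeriv`
  (`timeDerivWithin_of_mem_interior`), the pressure `lerayBackwardPressure a T P` is the `k = 0`
  gauge (`lerayBackwardPressure_eq_of_lt`), and the converse implication is the evaluation at the
  normalised time `t₀ = T − (2a)⁻¹`, `λ(t₀) = 1` (`lerayScale_sub_inv`,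
  `lerayBackwardPressure_apply_sub_inv`, `lerayBackward_apply_sub_inv`);
* the forward (expanding) twin `u = μ(t)U(μ(t)x)`, `μ(t) = (2at)^{-1/2}`, `μ' = −aμ³`
  (`hasDerivAt_lerayForwardScale`, `timeDeriv_lerayForward`, `laplacian_lerayForward`,
  `convect_lerayForward`, `divergence_lerayForward`, `gradient_lerayForwardPressure`,
  `IsForwardProfile.momentum_lerayForward`, `contDiffOn_uncurry_lerayForward(Pressure)`) and
  **`lerayForward_isClassical_iff_holds`**, the discharge of `lerayForward_isClassical_iff`
  (Jia–Šverák 2014, §1; evaluation at `t₀ = (2a)⁻¹` for the converse).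

The calculus statements are for the finite regularity `U ∈ C²`, `P ∈ C¹` of the pointwise
profile class and use the two-sided `timeDeriv` (the slab is open).

## Mathlib / tree search

Mathlib: `fderiv_comp_smul`, `fderiv_const_smul_field`, `HasDerivAt.sqrt`, `HasDerivAt.inv`,
`HasDerivAt.smul`, `HasFDerivAt.comp_hasDerivAt`, `ContDiffOn.sqrt`, `ContDiffOn.inv`, the
`module` tactic (all used). Tree: `laplacian_eq_sum_fderiv_fderiv` (`WholeSpaceIBP`);
`HarmonicProbe.laplacian_const_smul_comp_smul` and `MildSolutionProofs.laplacian_comp_smul` prove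
the same dilation rule for the Laplacian behind heavier imports (re-proved here in 15 lines);
`lerayBackward_apply_of_scale`, `continuousAt_uncurry_lerayBackward` (`TsaiLocalEnergy`).

## References

* J. Leray, *Sur le mouvement d'un liquide visqueux emplissant l'espace*, Acta Math. 63 (1934),
  193–248 (doi:10.1007/BF02547354), §20, p. 225: (3.11) the profile system
  `νΔU_i − α[U_i + x_k ∂_k U_i] − U_k ∂_k U_i − (1/ρ) ∂_i P = 0`, `∂_k U_k = 0` (`α > 0`), (3.12) the
  ansatz `u_i(x, t) = [2α(T − t)]^{-1/2} U_i([2α(T − t)]^{-1/2} x)`, `t < T` ("la solution des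
  équations de Navier dont il s'agit est (3.12)") [Leray1934].
* T.-P. Tsai, *On Leray's self-similar solutions of the Navier–Stokes equations satisfying local
  energy estimates*, Arch. Rational Mech. Anal. 143 (1998) 29–51, (1.1)–(1.3) (pp. 29–30),
  Lemma 4.1 (p. 46) [Tsai1998].
* H. Jia, V. Šverák, *Local-in-space estimates near initial time for weak solutions of the
  Navier–Stokes equations and forward self-similar solutions*, Invent. Math. 196 (2014) 233–265
  (arXiv:1204.0529), §1: `u(x, t) = t^{-1/2} U(x/√t)`, "The Navier–Stokes equation for `u` gives
  `−ΔU − ½U − ½x∇U + U∇U + ∇P = 0`, `div U = 0`" [JiaSverak2014].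
* P. G. Lemarié-Rieusset, *The Navier–Stokes Problem in the 21st Century* (CRC Press, 2016),
  §16.4 (forward and backward self-similar solutions; (16.19) the Leray equations)
  [LemarieRieusset2016].
-/

noncomputable section

open Set Function Filter Topology InnerProductSpace
open scoped Laplacian RealInnerProductSpace ContDiff

namespace Literature.Analysis.FluidPDE

/-! ### Dilations: `x ↦ k • U (c • x)` -/

section Dilation

variable {E : Type*} [NormedAddCommGroup E] [InnerProductSpace ℝ E] [FiniteDimensional ℝ E]
variable {F : Type*} [NormedAddCommGroup F] [NormedSpace ℝ F]

omit [InnerProductSpace ℝ E] [FiniteDimensional ℝ E] in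
/-- `D(k • U(c ·))(x) = (k c) • DU(c x)` (no differentiability needed: Mathlib's
`fderiv_comp_smul`, `fderiv_const_smul_field`). [folklore] -/
theorem fderiv_const_smul_comp_smul' [NormedSpace ℝ E] (U : E → F) (k c : ℝ) (x : E) :
    fderiv ℝ (fun y => k • U (c • y)) x = (k * c) • fderiv ℝ U (c • x) := by
  have h : (fun y => k • U (c • y)) = k • fun y => U (c • y) := rfl
  rw [h, fderiv_const_smul_field, Pi.smul_apply, _root_.fderiv_comp_smul, smul_smul]

omit [InnerProductSpace ℝ E] [FiniteDimensional ℝ E] in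
/-- `D(c • U(c ·))(x) = c² • DU(c x)`. [folklore] -/
theorem fderiv_smul_comp_smul [NormedSpace ℝ E] (U : E → F) (c : ℝ) (x : E) :
    fderiv ℝ (fun y => c • U (c • y)) x = c ^ 2 • fderiv ℝ U (c • x) := by
  rw [fderiv_const_smul_comp_smul', sq]

/-- `Δ(c • U(c ·))(x) = c³ • (ΔU)(c x)` for `U ∈ C²` (`Δ = Σᵢ ∂ᵢ∂ᵢ` in an orthonormal frame and
the chain rule twice). [folklore] -/
theorem laplacian_smul_comp_smul {F' : Type*} [NormedAddCommGroup F'] [InnerProductSpace ℝ F']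
    {U : E → F'} (hU : ContDiff ℝ 2 U) (c : ℝ) (x : E) :
    (Δ (fun y => c • U (c • y))) x = c ^ 3 • (Δ U) (c • x) := by
  set b := stdOrthonormalBasis ℝ E
  have hV : ContDiff ℝ 2 fun y => c • U (c • y) := (hU.comp (contDiff_const_smul c)).const_smul c
  rw [laplacian_eq_sum_fderiv_fderiv b hV, laplacian_eq_sum_fderiv_fderiv b hU, Finset.smul_sum]
  refine Finset.sum_congr rfl fun i _ => ?_
  set g : E → F' := fun z => fderiv ℝ U z (b i) with hg
  have h1 : (fun y => fderiv ℝ (fun y => c • U (c • y)) y (b i)) = fun y => c ^ 2 • g (c • y) := by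
    funext y
    rw [fderiv_smul_comp_smul U c y]
    rfl
  rw [h1, fderiv_const_smul_comp_smul' g (c ^ 2) c x]
  simp only [smul_apply, hg]
  rw [show c ^ 2 * c = c ^ 3 by ring]

omit [FiniteDimensional ℝ E] in
/-- `div (c • U(c ·))(x) = c² div U (c x)`. [folklore] -/
theorem divergence_smul_comp_smul (U : E → E) (c : ℝ) (x : E) :
    VectorCalculus.divergence (fun y => c • U (c • y)) x =
      c ^ 2 * VectorCalculus.divergence U (c • x) := by
  simp only [VectorCalculus.divergence, fderiv_smul_comp_smul U c x,
    ContinuousLinearMap.toLinearMap_smul, map_smul, smul_eq_mul]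

omit [FiniteDimensional ℝ E] in
/-- `(u·∇)u` for `u = c • U(c ·)`: `D u(x)(u x) = c³ • DU(c x)(U(c x))`. [folklore] -/
theorem convect_smul_comp_smul (U : E → E) (c : ℝ) (x : E) :
    convect (fun y => c • U (c • y)) (fun y => c • U (c • y)) x = c ^ 3 • convect U U (c • x) := by
  simp only [convect, fderiv_smul_comp_smul U c x, smul_apply, map_smul, smul_smul]
  congr 1
  ring

/-- `∇(c² (P(c ·) − k))(x) = c³ • (∇P)(c x)`. [folklore] -/
theorem gradient_sq_mul_comp_smul_sub (P : E → ℝ) (c k : ℝ) (x : E) :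
    gradient (fun y => c ^ 2 * (P (c • y) - k)) x = c ^ 3 • gradient P (c • x) := by
  have h : (fun y => c ^ 2 * (P (c • y) - k)) = fun y => c ^ 2 • (fun z => P z - k) (c • y) := by
    funext y; rfl
  rw [h, gradient, fderiv_const_smul_comp_smul' (fun z => P z - k) (c ^ 2) c x, fderiv_sub_const,
    map_smul, gradient, show c ^ 2 * c = c ^ 3 by ring]

end Dilation

/-! ### The scale factor `λ(t) = (2a(T − t))^{-1/2}` of Leray's backward ansatz -/

section Scale

variable {a T t : ℝ}

/-- `2a(T − t) > 0` for `a > 0`, `t < T`. [folklore] -/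
theorem lerayScale_arg_pos (ha : 0 < a) (ht : t < T) : 0 < 2 * a * (T - t) :=
  mul_pos (mul_pos two_pos ha) (sub_pos.2 ht)

/-- `λ(t) = (2a(T − t))^{-1/2} > 0` for `t < T`. [folklore] -/
theorem lerayScale_pos (ha : 0 < a) (ht : t < T) : 0 < (Real.sqrt (2 * a * (T - t)))⁻¹ :=
  inv_pos.2 (Real.sqrt_pos.2 (lerayScale_arg_pos ha ht))

/-- `λ(t)² = (2a(T − t))⁻¹`. [folklore] -/
theorem lerayScale_sq (ha : 0 < a) (ht : t < T) :
    ((Real.sqrt (2 * a * (T - t)))⁻¹) ^ 2 = (2 * a * (T - t))⁻¹ := by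
  rw [inv_pow, Real.sq_sqrt (lerayScale_arg_pos ha ht).le]

/-- **`λ' = a λ³`** (Leray 1934, (3.11); Tsai 1998, (1.2): `λ(t) = (2a(T − t))^{-1/2}`). [cite: Tsai1998, (1.2) p. 29] -/
theorem hasDerivAt_lerayScale (ha : 0 < a) (ht : t < T) :
    HasDerivAt (fun s => (Real.sqrt (2 * a * (T - s)))⁻¹)
      (a * ((Real.sqrt (2 * a * (T - t)))⁻¹) ^ 3) t := by
  have hpos := lerayScale_arg_pos ha ht
  have hg : HasDerivAt (fun s => 2 * a * (T - s)) (2 * a * (-1)) t := by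
    have := ((hasDerivAt_id t).const_sub T).const_mul (2 * a)
    simpa using this
  have hsqrt := hg.sqrt hpos.ne'
  have hne : Real.sqrt (2 * a * (T - t)) ≠ 0 := (Real.sqrt_pos.2 hpos).ne'
  have hinv := hsqrt.inv hne
  refine hinv.congr_deriv ?_
  rw [inv_pow]
  field_simp

/-- `λ` is smooth on `(-∞, T)`. [folklore] -/
theorem contDiffOn_lerayScale (ha : 0 < a) {n : WithTop ℕ∞} :
    ContDiffOn ℝ n (fun s => (Real.sqrt (2 * a * (T - s)))⁻¹) (Iio T) := by
  have h1 : ContDiffOn ℝ n (fun s => 2 * a * (T - s)) (Iio T) :=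
    (contDiff_const.mul (contDiff_const.sub contDiff_id)).contDiffOn
  have hne : ∀ s ∈ Iio T, 2 * a * (T - s) ≠ 0 := fun s hs => (lerayScale_arg_pos ha hs).ne'
  refine (h1.sqrt hne).inv fun s hs => ?_
  exact (Real.sqrt_pos.2 (lerayScale_arg_pos ha hs)).ne'

end Scale

/-! ### Slices and time lines of `u(t, x) = λ(t) U(λ(t) x)`, `p(t, x) = λ(t)² (P(λ(t) x) − k)` -/

section Field

variable {E : Type*} [NormedAddCommGroup E] [InnerProductSpace ℝ E] [FiniteDimensional ℝ E]
variable {a T t ν : ℝ} {U : E → E} {P : E → ℝ}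

omit [FiniteDimensional ℝ E] in
/-- The slice derivative: `D(u(t))(x) = λ² • DU(λx)`, `u = lerayBackward a T U`. [folklore] -/
theorem fderiv_lerayBackward (a T : ℝ) (U : E → E) (t : ℝ) (x : E) :
    fderiv ℝ (lerayBackward a T U t) x =
      ((Real.sqrt (2 * a * (T - t)))⁻¹) ^ 2 •
        fderiv ℝ U ((Real.sqrt (2 * a * (T - t)))⁻¹ • x) :=
  fderiv_smul_comp_smul U _ x

/-- The slice Laplacian: `Δ(u(t))(x) = λ³ • (ΔU)(λx)` for `U ∈ C²`. [folklore] -/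
theorem laplacian_lerayBackward (hU : ContDiff ℝ 2 U) (a T t : ℝ) (x : E) :
    (Δ (lerayBackward a T U t)) x =
      ((Real.sqrt (2 * a * (T - t)))⁻¹) ^ 3 •
        (Δ U) ((Real.sqrt (2 * a * (T - t)))⁻¹ • x) :=
  laplacian_smul_comp_smul hU _ x

omit [FiniteDimensional ℝ E] in
/-- The slice convection term: `(u·∇)u (t, x) = λ³ • ((U·∇)U)(λx)`. [folklore] -/
theorem convect_lerayBackward (a T : ℝ) (U : E → E) (t : ℝ) (x : E) :
    convect (lerayBackward a T U t) (lerayBackward a T U t) x =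
      ((Real.sqrt (2 * a * (T - t)))⁻¹) ^ 3 •
        convect U U ((Real.sqrt (2 * a * (T - t)))⁻¹ • x) :=
  convect_smul_comp_smul U _ x

omit [FiniteDimensional ℝ E] in
/-- The slice divergence: `div u(t) (x) = λ² div U (λx)`; in particular `u(t)` is divergence
free when `U` is. [folklore] -/
theorem divergence_lerayBackward (a T : ℝ) (U : E → E) (t : ℝ) (x : E) :
    VectorCalculus.divergence (lerayBackward a T U t) x =
      ((Real.sqrt (2 * a * (T - t)))⁻¹) ^ 2 *
        VectorCalculus.divergence U ((Real.sqrt (2 * a * (T - t)))⁻¹ • x) :=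
  divergence_smul_comp_smul U _ x

/-- The gradient of the self-similar pressure slice `x ↦ λ² (P(λx) − k)`: `λ³ • (∇P)(λx)`. [folklore] -/
theorem gradient_lerayBackwardPressure_sub (a T : ℝ) (P : E → ℝ) (k t : ℝ) (x : E) :
    gradient (fun y => ((Real.sqrt (2 * a * (T - t)))⁻¹) ^ 2 *
        (P ((Real.sqrt (2 * a * (T - t)))⁻¹ • y) - k)) x =
      ((Real.sqrt (2 * a * (T - t)))⁻¹) ^ 3 • gradient P ((Real.sqrt (2 * a * (T - t)))⁻¹ • x) :=
  gradient_sq_mul_comp_smul_sub P _ k x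

omit [FiniteDimensional ℝ E] in
/-- **The time line.** For `U ∈ C¹`, `a > 0`, `t < T`: `∂ₜ u(t, x) = a λ³ • (U(y) + DU(y) y)`,
`y = λ(t) x` (product and chain rule with `λ' = a λ³`; Leray 1934, §20; Tsai 1998, the passage
from (1.1)–(1.2) to (1.3)). [cite: Tsai1998, (1.2)–(1.3) pp. 29–30] -/
theorem hasDerivAt_lerayBackward_time (ha : 0 < a) (ht : t < T) (hU : ContDiff ℝ 1 U) (x : E) :
    HasDerivAt (fun s => lerayBackward a T U s x)
      ((a * ((Real.sqrt (2 * a * (T - t)))⁻¹) ^ 3) •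
        (U ((Real.sqrt (2 * a * (T - t)))⁻¹ • x) +
          fderiv ℝ U ((Real.sqrt (2 * a * (T - t)))⁻¹ • x)
            ((Real.sqrt (2 * a * (T - t)))⁻¹ • x))) t := by
  set L : ℝ → ℝ := fun s => (Real.sqrt (2 * a * (T - s)))⁻¹ with hL
  have h1 : HasDerivAt L (a * L t ^ 3) t := hasDerivAt_lerayScale ha ht
  have h2 : HasDerivAt (fun s => U (L s • x)) (fderiv ℝ U (L t • x) ((a * L t ^ 3) • x)) t :=
    ((hU.differentiable one_ne_zero (L t • x)).hasFDerivAt).comp_hasDerivAt t (h1.smul_const x)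
  have h3 := h1.smul h2
  have he : (fun s => lerayBackward a T U s x) = fun s => L s • U (L s • x) := rfl
  rw [he]
  refine h3.congr_deriv ?_
  simp only [map_smul]
  module

omit [FiniteDimensional ℝ E] in
/-- The two-sided time derivative of Leray's backward field below the blow-up time:
`timeDeriv u t x = a λ³ • (U(λx) + DU(λx)(λx))`. [folklore] -/
theorem timeDeriv_lerayBackward (ha : 0 < a) (ht : t < T) (hU : ContDiff ℝ 1 U) (x : E) :
    timeDeriv (lerayBackward a T U) t x =
      (a * ((Real.sqrt (2 * a * (T - t)))⁻¹) ^ 3) •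
        (U ((Real.sqrt (2 * a * (T - t)))⁻¹ • x) +
          fderiv ℝ U ((Real.sqrt (2 * a * (T - t)))⁻¹ • x)
            ((Real.sqrt (2 * a * (T - t)))⁻¹ • x)) :=
  (hasDerivAt_lerayBackward_time ha ht hU x).deriv

omit [FiniteDimensional ℝ E] in
/-- Leray's backward field of a divergence-free profile is divergence free at every time
(`div u(t) = λ² div U (λ·)`). [folklore] -/
theorem isDivFree_lerayBackward (hU : VectorCalculus.IsDivFree U) (a T t : ℝ) :
    VectorCalculus.IsDivFree (lerayBackward a T U t) := fun x => by
  rw [divergence_lerayBackward, hU, mul_zero]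

/-- **Leray's reduction, backward direction** (Leray 1934, §20, (3.11)–(3.12); Tsai 1998,
(1.1)–(1.3): "The Navier–Stokes equations for `u` give the system (1.3) for `U`"). If `(U, P)`
solves the profile system `−νΔU + aU + a(y·∇)U + (U·∇)U + ∇P = 0` (`IsLerayProfile ν a U P`),
then below the blow-up time `u = λ(t)U(λ(t)x)` and, for any constant `k`, the pressure
`p = λ(t)² (P(λ(t)x) − k)` satisfy the Navier–Stokes momentum equation pointwise:
`∂ₜu + (u·∇)u = νΔu − ∇p` at every `(t, x)` with `t < T` (every term is `λ³` times the
corresponding profile term at `y = λx`, by `λ' = aλ³`). The freedom `k` is the gauge of the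
pressure used by Tsai's Lemma 4.1 (`p = λ² P̃(λx)`, `P̃ = P − k`). [cite: Tsai1998, (1.1)–(1.3) pp. 29–30] -/
theorem IsLerayProfile.momentum_lerayBackward (h : IsLerayProfile ν a U P) (ha : 0 < a)
    (ht : t < T) (k : ℝ) (x : E) :
    timeDeriv (lerayBackward a T U) t x +
        convect (lerayBackward a T U t) (lerayBackward a T U t) x =
      ν • (Δ (lerayBackward a T U t)) x -
        gradient (fun y => ((Real.sqrt (2 * a * (T - t)))⁻¹) ^ 2 *
          (P ((Real.sqrt (2 * a * (T - t)))⁻¹ • y) - k)) x + (0 : ℝ → E → E) t x := by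
  set L : ℝ := (Real.sqrt (2 * a * (T - t)))⁻¹ with hL
  set y : E := L • x with hy
  rw [timeDeriv_lerayBackward ha ht (h.contDiff_velocity.of_le one_le_two) x,
    convect_lerayBackward, laplacian_lerayBackward h.contDiff_velocity,
    gradient_lerayBackwardPressure_sub]
  simp only [← hL, ← hy, Pi.zero_apply, add_zero]
  have key := h.profile_eq y
  have key' : a • U y + a • fderiv ℝ U y y + convect U U y = ν • (Δ U) y - gradient P y := by
    rw [eq_sub_iff_add_eq, ← sub_eq_zero, ← key]
    abel
  have : (a * L ^ 3) • (U y + fderiv ℝ U y y) + L ^ 3 • convect U U y =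
      L ^ 3 • (a • U y + a • fderiv ℝ U y y + convect U U y) := by
    module
  rw [this, key', smul_sub, smul_comm (L ^ 3) ν]

/-! ### Joint regularity on the open slab `(-∞, T) × E` -/

omit [FiniteDimensional ℝ E] in
/-- `(t, x) ↦ λ(t)U(λ(t)x)` is jointly `Cⁿ` on `(-∞, T) × E` when `U ∈ Cⁿ` (`λ` is smooth there). [folklore] -/
theorem contDiffOn_uncurry_lerayBackward (ha : 0 < a) {n : WithTop ℕ∞} (hU : ContDiff ℝ n U)
    (T : ℝ) : ContDiffOn ℝ n (uncurry (lerayBackward a T U)) (Iio T ×ˢ univ) := by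
  have hL : ContDiffOn ℝ n (fun z : ℝ × E => (Real.sqrt (2 * a * (T - z.1)))⁻¹) (Iio T ×ˢ univ) :=
    (contDiffOn_lerayScale ha).comp contDiff_fst.contDiffOn fun z hz => hz.1
  have hLx : ContDiffOn ℝ n (fun z : ℝ × E => (Real.sqrt (2 * a * (T - z.1)))⁻¹ • z.2)
      (Iio T ×ˢ univ) := hL.smul contDiff_snd.contDiffOn
  have hU' : ContDiffOn ℝ n (fun z : ℝ × E => U ((Real.sqrt (2 * a * (T - z.1)))⁻¹ • z.2))
      (Iio T ×ˢ univ) := hU.comp_contDiffOn hLx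
  exact hL.smul hU'

omit [FiniteDimensional ℝ E] in
/-- `(t, x) ↦ λ(t)² (P(λ(t)x) − k)` is jointly `Cⁿ` on `(-∞, T) × E` when `P ∈ Cⁿ`. [folklore] -/
theorem contDiffOn_uncurry_lerayBackwardPressure_sub (ha : 0 < a) {n : WithTop ℕ∞}
    (hP : ContDiff ℝ n P) (T k : ℝ) :
    ContDiffOn ℝ n (uncurry fun (t : ℝ) (x : E) => ((Real.sqrt (2 * a * (T - t)))⁻¹) ^ 2 *
      (P ((Real.sqrt (2 * a * (T - t)))⁻¹ • x) - k)) (Iio T ×ˢ univ) := by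
  have hL : ContDiffOn ℝ n (fun z : ℝ × E => (Real.sqrt (2 * a * (T - z.1)))⁻¹) (Iio T ×ˢ univ) :=
    (contDiffOn_lerayScale ha).comp contDiff_fst.contDiffOn fun z hz => hz.1
  have hLx : ContDiffOn ℝ n (fun z : ℝ × E => (Real.sqrt (2 * a * (T - z.1)))⁻¹ • z.2)
      (Iio T ×ˢ univ) := hL.smul contDiff_snd.contDiffOn
  have hP' : ContDiffOn ℝ n (fun z : ℝ × E => P ((Real.sqrt (2 * a * (T - z.1)))⁻¹ • z.2) - k)
      (Iio T ×ˢ univ) := (hP.comp_contDiffOn hLx).sub contDiffOn_const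
  exact (hL.pow 2).mul hP'

omit [FiniteDimensional ℝ E] in
/-- Joint continuity of `u = λ(t)U(λ(t)x)` on `(-∞, T) × E` for continuous `U`. [folklore] -/
theorem continuousOn_uncurry_lerayBackward (ha : 0 < a) (hU : Continuous U) (T : ℝ) :
    ContinuousOn (uncurry (lerayBackward a T U)) (Iio T ×ˢ univ) := by
  have := contDiffOn_uncurry_lerayBackward (n := 0) ha (contDiff_zero.2 hU) T
  exact this.continuousOn

end Field

/-! ### Leray's reduction as an `iff` (discharge of `lerayBackward_isClassical_iff`) -/

section Reduction

/-- At the normalised time `t = T − (2a)⁻¹` the scale factor is `λ = 1`. [folklore] -/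
theorem lerayScale_sub_inv {a : ℝ} (ha : 0 < a) (T : ℝ) :
    (Real.sqrt (2 * a * (T - (T - (2 * a)⁻¹))))⁻¹ = 1 := by
  have h2a : (2 * a) ≠ 0 := by positivity
  rw [sub_sub_cancel, mul_inv_cancel₀ h2a, Real.sqrt_one, inv_one]

variable {E : Type*} [NormedAddCommGroup E] [InnerProductSpace ℝ E]
variable {a T t : ℝ}

/-- At the normalised time `t = T − (2a)⁻¹` the backward pressure ansatz is the pressure profile
itself: `lerayBackwardPressure a T P (T − (2a)⁻¹) = P` (twin of `lerayBackward_apply_sub_inv`). [folklore] -/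
theorem lerayBackwardPressure_apply_sub_inv (ha : 0 < a) (T : ℝ) (P : E → ℝ) :
    lerayBackwardPressure a T P (T - (2 * a)⁻¹) = P := by
  funext x
  have h2a : (2 * a) ≠ 0 := by positivity
  have h1 : 2 * a * (T - (T - (2 * a)⁻¹)) = 1 := by rw [sub_sub_cancel, mul_inv_cancel₀ h2a]
  simp only [lerayBackwardPressure, h1, Real.sqrt_one, inv_one, one_smul, one_mul]

/-- Below the blow-up time the backward pressure ansatz is the `k = 0` case of the gauged pressure
slice `x ↦ λ² (P(λx) − k)` of this file (`λ² = (2a(T − t))⁻¹`, `lerayScale_sq`). [folklore] -/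
theorem lerayBackwardPressure_eq_of_lt (ha : 0 < a) (ht : t < T) (P : E → ℝ) :
    lerayBackwardPressure a T P t = fun y => ((Real.sqrt (2 * a * (T - t)))⁻¹) ^ 2 *
      (P ((Real.sqrt (2 * a * (T - t)))⁻¹ • y) - 0) := by
  funext y
  rw [sub_zero, lerayScale_sq ha ht]
  rfl

variable [FiniteDimensional ℝ E]

/-- **Leray's reduction** (discharge of the named fact `lerayBackward_isClassical_iff` of
`SelfSimilar.lean`; Leray 1934, §20, p. 225: the profile system (3.11)
`νΔU_i − α[U_i + x_k ∂_k U_i] − U_k ∂_k U_i − ∂_i P = 0`, `∂_k U_k = 0` and the ansatz (3.12)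
`u_i(x, t) = [2α(T − t)]^{-1/2} U_i([2α(T − t)]^{-1/2} x)`, `t < T`; Tsai 1998, (1.1)–(1.3)). For
`C^∞` profiles `U`, `P` and `0 < a`, the pair `(lerayBackward a T U, lerayBackwardPressure a T P)`
is a classical unforced Navier–Stokes solution on the open slab `(-∞, T) × E` **iff** `(U, P)`
solves the profile system `IsLerayProfile ν a U P`.

*Backward direction* (the one Leray states): joint smoothness on the slab is
`contDiffOn_uncurry_lerayBackward` / `contDiffOn_uncurry_lerayBackwardPressure_sub` (`λ` is smooth
on `(-∞, T)`); on the open time set the one-sided time derivative `timeDerivWithin (Iio T)` is the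
two-sided one (`timeDerivWithin_of_mem_interior`), and the momentum equation is
`IsLerayProfile.momentum_lerayBackward` with gauge `k = 0` (every term is `λ³` times the profile
term at `y = λx`, `λ' = aλ³`); incompressibility is `isDivFree_lerayBackward`.
*Forward direction*: evaluate the equations at the normalised time `t₀ = T − (2a)⁻¹`, where
`λ = 1`, `λ' = a`, `u(t₀) = U`, `p(t₀) = P` (`lerayBackward_apply_sub_inv`,
`lerayBackwardPressure_apply_sub_inv`) and `∂ₜu(t₀) = a(U + (y·∇)U)` (`timeDeriv_lerayBackward`).
[cite: Leray1934, §20 (3.11)–(3.12) p. 225] -/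
theorem lerayBackward_isClassical_iff_holds : lerayBackward_isClassical_iff (E := E) := by
  intro ν a T ha U P hU hP
  have hU1 : ContDiff ℝ 1 U := hU.of_le (by norm_cast)
  constructor
  · -- classical solution ⟹ profile: evaluate at `t₀ = T − (2a)⁻¹`, where `λ = 1`
    intro h
    have ht₀ : T - (2 * a)⁻¹ < T := sub_lt_self T (inv_pos.2 (by positivity))
    have hmem : T - (2 * a)⁻¹ ∈ Iio T := ht₀
    have hint : T - (2 * a)⁻¹ ∈ interior (Iio T) := by rwa [interior_Iio]
    have hu₀ : lerayBackward a T U (T - (2 * a)⁻¹) = U := lerayBackward_apply_sub_inv ha T U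
    have hp₀ : lerayBackwardPressure a T P (T - (2 * a)⁻¹) = P :=
      lerayBackwardPressure_apply_sub_inv ha T P
    refine ⟨hU.of_le (by norm_cast), hP.of_le (by norm_cast), fun y => ?_, fun y => ?_⟩
    · have hm := h.momentum _ hmem y
      rw [timeDerivWithin_of_mem_interior hint y, timeDeriv_lerayBackward ha ht₀ hU1 y,
        lerayScale_sub_inv ha T, hu₀, hp₀] at hm
      simp only [one_pow, mul_one, one_smul, smul_add, Pi.zero_apply, add_zero] at hm
      calc -(ν • (Δ U) y) + a • U y + a • fderiv ℝ U y y + convect U U y + gradient P y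
          = (a • U y + a • fderiv ℝ U y y + convect U U y) - (ν • (Δ U) y - gradient P y) := by
            abel
        _ = 0 := by rw [hm, sub_self]
    · have hd := h.divFree _ hmem y
      rwa [hu₀] at hd
  · -- profile ⟹ classical solution on `(-∞, T) × E`
    intro h
    have hsu : IsSmoothSpaceTimeOn (Iio T) (lerayBackward a T U) :=
      contDiffOn_uncurry_lerayBackward ha hU T
    have hsp : IsSmoothSpaceTimeOn (Iio T) (lerayBackwardPressure a T P) := by
      show ContDiffOn ℝ ∞ (uncurry (lerayBackwardPressure a T P)) (Iio T ×ˢ univ)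
      refine (contDiffOn_uncurry_lerayBackwardPressure_sub ha hP T 0).congr ?_
      rintro ⟨t, x⟩ hz
      have ht : t < T := hz.1
      simp only [uncurry_apply_pair, lerayBackwardPressure_eq_of_lt ha ht P]
    refine ⟨hsu, hsp, fun t ht x => ?_, fun t _ => isDivFree_lerayBackward h.divFree a T t⟩
    have ht' : t < T := ht
    have hint : t ∈ interior (Iio T) := by rwa [interior_Iio]
    rw [timeDerivWithin_of_mem_interior hint x, lerayBackwardPressure_eq_of_lt ha ht' P]
    exact h.momentum_lerayBackward ha ht' 0 x

end Reduction

/-! ### The forward (expanding) ansatz `u(t, x) = μ(t) U(μ(t) x)`, `μ(t) = (2at)^{-1/2}`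
(discharge of `lerayForward_isClassical_iff`)

Leray's §20 treats only the backward ansatz; the forward (expanding) self-similar solutions
`u(x, t) = t^{-1/2} U(x/√t)` (the normalisation `2a = 1`, `ν = 1`) and their profile system
`−ΔU − ½U − ½ x·∇U + U·∇U + ∇P = 0`, `div U = 0` are those of Jia–Šverák 2014, §1 ("The
Navier–Stokes equation for `u` gives …"); Lemarié-Rieusset 2016, §16.4. The vendored
`lerayForward a U t = lerayBackward a T U (T − t)` (`lerayBackward_eq_lerayForward`) carries the
general rate `a > 0` and viscosity `ν`. -/

section Forward

variable {a t : ℝ}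

/-- `2at > 0` for `a > 0`, `t > 0`. [folklore] -/
theorem lerayForwardScale_arg_pos (ha : 0 < a) (ht : 0 < t) : 0 < 2 * a * t :=
  mul_pos (mul_pos two_pos ha) ht

/-- `μ(t) = (2at)^{-1/2} > 0` for `t > 0`. [folklore] -/
theorem lerayForwardScale_pos (ha : 0 < a) (ht : 0 < t) : 0 < (Real.sqrt (2 * a * t))⁻¹ :=
  inv_pos.2 (Real.sqrt_pos.2 (lerayForwardScale_arg_pos ha ht))

/-- `μ(t)² = (2at)⁻¹` for `t > 0`. [folklore] -/
theorem lerayForwardScale_sq (ha : 0 < a) (ht : 0 < t) :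
    ((Real.sqrt (2 * a * t))⁻¹) ^ 2 = (2 * a * t)⁻¹ := by
  rw [inv_pow, Real.sq_sqrt (lerayForwardScale_arg_pos ha ht).le]

/-- At the normalised time `t = (2a)⁻¹` the forward scale factor is `μ = 1`. [folklore] -/
theorem lerayForwardScale_inv (ha : 0 < a) : (Real.sqrt (2 * a * (2 * a)⁻¹))⁻¹ = 1 := by
  have h2a : (2 * a) ≠ 0 := by positivity
  rw [mul_inv_cancel₀ h2a, Real.sqrt_one, inv_one]

/-- **`μ' = −a μ³`** for the forward scale factor `μ(t) = (2at)^{-1/2}`, `t > 0`. [folklore] -/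
theorem hasDerivAt_lerayForwardScale (ha : 0 < a) (ht : 0 < t) :
    HasDerivAt (fun s => (Real.sqrt (2 * a * s))⁻¹)
      (-(a * ((Real.sqrt (2 * a * t))⁻¹) ^ 3)) t := by
  have hpos := lerayForwardScale_arg_pos ha ht
  have hg : HasDerivAt (fun s => 2 * a * s) (2 * a) t := by
    simpa using (hasDerivAt_id t).const_mul (2 * a)
  have hsqrt := hg.sqrt hpos.ne'
  have hne : Real.sqrt (2 * a * t) ≠ 0 := (Real.sqrt_pos.2 hpos).ne'
  have hinv := hsqrt.inv hne
  refine hinv.congr_deriv ?_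
  rw [inv_pow]
  field_simp

/-- `μ` is smooth on `(0, ∞)`. [folklore] -/
theorem contDiffOn_lerayForwardScale (ha : 0 < a) {n : WithTop ℕ∞} :
    ContDiffOn ℝ n (fun s => (Real.sqrt (2 * a * s))⁻¹) (Ioi 0) := by
  have h1 : ContDiffOn ℝ n (fun s => 2 * a * s) (Ioi 0) :=
    (contDiff_const.mul contDiff_id).contDiffOn
  have hne : ∀ s ∈ Ioi (0 : ℝ), 2 * a * s ≠ 0 := fun s hs => (lerayForwardScale_arg_pos ha hs).ne'
  refine (h1.sqrt hne).inv fun s hs => ?_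
  exact (Real.sqrt_pos.2 (lerayForwardScale_arg_pos ha hs)).ne'

variable {E : Type*} [NormedAddCommGroup E] [InnerProductSpace ℝ E] [FiniteDimensional ℝ E]
variable {ν : ℝ} {U : E → E} {P : E → ℝ}

omit [FiniteDimensional ℝ E] in
/-- The slice derivative of the forward field: `D(u(t))(x) = μ² • DU(μx)`. [folklore] -/
theorem fderiv_lerayForward (a : ℝ) (U : E → E) (t : ℝ) (x : E) :
    fderiv ℝ (lerayForward a U t) x =
      ((Real.sqrt (2 * a * t))⁻¹) ^ 2 • fderiv ℝ U ((Real.sqrt (2 * a * t))⁻¹ • x) :=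
  fderiv_smul_comp_smul U _ x

/-- The slice Laplacian of the forward field: `Δ(u(t))(x) = μ³ • (ΔU)(μx)` for `U ∈ C²`. [folklore] -/
theorem laplacian_lerayForward (hU : ContDiff ℝ 2 U) (a t : ℝ) (x : E) :
    (Δ (lerayForward a U t)) x =
      ((Real.sqrt (2 * a * t))⁻¹) ^ 3 • (Δ U) ((Real.sqrt (2 * a * t))⁻¹ • x) :=
  laplacian_smul_comp_smul hU _ x

omit [FiniteDimensional ℝ E] in
/-- The slice convection term of the forward field: `(u·∇)u (t, x) = μ³ • ((U·∇)U)(μx)`. [folklore] -/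
theorem convect_lerayForward (a : ℝ) (U : E → E) (t : ℝ) (x : E) :
    convect (lerayForward a U t) (lerayForward a U t) x =
      ((Real.sqrt (2 * a * t))⁻¹) ^ 3 • convect U U ((Real.sqrt (2 * a * t))⁻¹ • x) :=
  convect_smul_comp_smul U _ x

omit [FiniteDimensional ℝ E] in
/-- The slice divergence of the forward field: `div u(t) (x) = μ² div U (μx)`. [folklore] -/
theorem divergence_lerayForward (a : ℝ) (U : E → E) (t : ℝ) (x : E) :
    VectorCalculus.divergence (lerayForward a U t) x =
      ((Real.sqrt (2 * a * t))⁻¹) ^ 2 *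
        VectorCalculus.divergence U ((Real.sqrt (2 * a * t))⁻¹ • x) :=
  divergence_smul_comp_smul U _ x

omit [FiniteDimensional ℝ E] in
/-- The forward field of a divergence-free profile is divergence free at every time. [folklore] -/
theorem isDivFree_lerayForward (hU : VectorCalculus.IsDivFree U) (a t : ℝ) :
    VectorCalculus.IsDivFree (lerayForward a U t) := fun x => by
  rw [divergence_lerayForward, hU, mul_zero]

omit [FiniteDimensional ℝ E] in
/-- For `0 < t` the forward pressure ansatz `x ↦ (2at)⁻¹ P(μx)` is the gauge-`0` slice
`x ↦ μ² (P(μx) − 0)` (`μ² = (2at)⁻¹`). [folklore] -/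
theorem lerayForwardPressure_eq_of_pos (ha : 0 < a) (ht : 0 < t) (P : E → ℝ) :
    lerayForwardPressure a P t = fun y => ((Real.sqrt (2 * a * t))⁻¹) ^ 2 *
      (P ((Real.sqrt (2 * a * t))⁻¹ • y) - 0) := by
  funext y
  rw [sub_zero, lerayForwardScale_sq ha ht]
  rfl

/-- The gradient of the forward pressure slice: `∇p(t) (x) = μ³ • (∇P)(μx)`, `0 < t`. [folklore] -/
theorem gradient_lerayForwardPressure (ha : 0 < a) (ht : 0 < t) (P : E → ℝ) (x : E) :
    gradient (lerayForwardPressure a P t) x =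
      ((Real.sqrt (2 * a * t))⁻¹) ^ 3 • gradient P ((Real.sqrt (2 * a * t))⁻¹ • x) := by
  rw [lerayForwardPressure_eq_of_pos ha ht P]
  exact gradient_sq_mul_comp_smul_sub P _ 0 x

omit [FiniteDimensional ℝ E] in
/-- At the normalised time `t = (2a)⁻¹` the forward pressure ansatz is the pressure profile
(twin of `lerayForward_apply_inv`). [folklore] -/
theorem lerayForwardPressure_apply_inv (ha : 0 < a) (P : E → ℝ) :
    lerayForwardPressure a P (2 * a)⁻¹ = P := by
  funext x
  have h2a : (2 * a) ≠ 0 := by positivity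
  simp only [lerayForwardPressure, mul_inv_cancel₀ h2a, Real.sqrt_one, inv_one, one_smul, one_mul]

omit [FiniteDimensional ℝ E] in
/-- **The time line of the forward field.** For `U ∈ C¹`, `a > 0`, `0 < t`:
`∂ₜ u(t, x) = −a μ³ • (U(y) + DU(y) y)`, `y = μ(t) x` (product and chain rule with
`μ' = −aμ³`). [folklore] -/
theorem hasDerivAt_lerayForward_time (ha : 0 < a) (ht : 0 < t) (hU : ContDiff ℝ 1 U) (x : E) :
    HasDerivAt (fun s => lerayForward a U s x)
      ((-(a * ((Real.sqrt (2 * a * t))⁻¹) ^ 3)) •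
        (U ((Real.sqrt (2 * a * t))⁻¹ • x) +
          fderiv ℝ U ((Real.sqrt (2 * a * t))⁻¹ • x) ((Real.sqrt (2 * a * t))⁻¹ • x))) t := by
  set L : ℝ → ℝ := fun s => (Real.sqrt (2 * a * s))⁻¹ with hL
  have h1 : HasDerivAt L (-(a * L t ^ 3)) t := hasDerivAt_lerayForwardScale ha ht
  have h2 : HasDerivAt (fun s => U (L s • x)) (fderiv ℝ U (L t • x) ((-(a * L t ^ 3)) • x)) t :=
    ((hU.differentiable one_ne_zero (L t • x)).hasFDerivAt).comp_hasDerivAt t (h1.smul_const x)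
  have h3 := h1.smul h2
  have he : (fun s => lerayForward a U s x) = fun s => L s • U (L s • x) := rfl
  rw [he]
  refine h3.congr_deriv ?_
  simp only [map_smul]
  module

omit [FiniteDimensional ℝ E] in
/-- The two-sided time derivative of the forward field for `0 < t`:
`timeDeriv u t x = −a μ³ • (U(μx) + DU(μx)(μx))`. [folklore] -/
theorem timeDeriv_lerayForward (ha : 0 < a) (ht : 0 < t) (hU : ContDiff ℝ 1 U) (x : E) :
    timeDeriv (lerayForward a U) t x =
      (-(a * ((Real.sqrt (2 * a * t))⁻¹) ^ 3)) •
        (U ((Real.sqrt (2 * a * t))⁻¹ • x) +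
          fderiv ℝ U ((Real.sqrt (2 * a * t))⁻¹ • x) ((Real.sqrt (2 * a * t))⁻¹ • x)) :=
  (hasDerivAt_lerayForward_time ha ht hU x).deriv

/-- **The forward reduction, direction profile ⟹ solution** (Jia–Šverák 2014, §1: for
`u = t^{-1/2} U(x/√t)` "the Navier–Stokes equation for `u` gives
`−ΔU − ½U − ½ x∇U + U∇U + ∇P = 0`, `div U = 0`"; here with general rate `a` and viscosity `ν`):
if `(U, P)` solves the forward profile system `−νΔU − aU − a(y·∇)U + (U·∇)U + ∇P = 0`
(`IsForwardProfile ν a U P`), then for `0 < t` the pair `u = μ(t)U(μ(t)x)`,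
`p = (2at)⁻¹ P(μ(t)x)` satisfies `∂ₜu + (u·∇)u = νΔu − ∇p` pointwise (every term is `μ³` times
the corresponding profile term at `y = μx`, by `μ' = −aμ³`). [cite: JiaSverak2014, §1] -/
theorem IsForwardProfile.momentum_lerayForward (h : IsForwardProfile ν a U P) (ha : 0 < a)
    (ht : 0 < t) (x : E) :
    timeDeriv (lerayForward a U) t x +
        convect (lerayForward a U t) (lerayForward a U t) x =
      ν • (Δ (lerayForward a U t)) x - gradient (lerayForwardPressure a P t) x +
        (0 : ℝ → E → E) t x := by
  set L : ℝ := (Real.sqrt (2 * a * t))⁻¹ with hL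
  set y : E := L • x with hy
  rw [timeDeriv_lerayForward ha ht (h.contDiff_velocity.of_le one_le_two) x,
    convect_lerayForward, laplacian_lerayForward h.contDiff_velocity,
    gradient_lerayForwardPressure ha ht]
  simp only [← hL, ← hy, Pi.zero_apply, add_zero]
  have key := h.profile_eq y
  have key' : -(a • U y) - a • fderiv ℝ U y y + convect U U y = ν • (Δ U) y - gradient P y := by
    rw [eq_sub_iff_add_eq, ← sub_eq_zero, ← key]
    abel
  have : (-(a * L ^ 3)) • (U y + fderiv ℝ U y y) + L ^ 3 • convect U U y =
      L ^ 3 • (-(a • U y) - a • fderiv ℝ U y y + convect U U y) := by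
    module
  rw [this, key', smul_sub, smul_comm (L ^ 3) ν]

omit [FiniteDimensional ℝ E] in
/-- `(t, x) ↦ μ(t)U(μ(t)x)` is jointly `Cⁿ` on `(0, ∞) × E` when `U ∈ Cⁿ`. [folklore] -/
theorem contDiffOn_uncurry_lerayForward (ha : 0 < a) {n : WithTop ℕ∞} (hU : ContDiff ℝ n U) :
    ContDiffOn ℝ n (uncurry (lerayForward a U)) (Ioi 0 ×ˢ univ) := by
  have hL : ContDiffOn ℝ n (fun z : ℝ × E => (Real.sqrt (2 * a * z.1))⁻¹) (Ioi 0 ×ˢ univ) :=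
    (contDiffOn_lerayForwardScale ha).comp contDiff_fst.contDiffOn fun z hz => hz.1
  have hLx : ContDiffOn ℝ n (fun z : ℝ × E => (Real.sqrt (2 * a * z.1))⁻¹ • z.2)
      (Ioi 0 ×ˢ univ) := hL.smul contDiff_snd.contDiffOn
  exact hL.smul (hU.comp_contDiffOn hLx)

omit [FiniteDimensional ℝ E] in
/-- `(t, x) ↦ (2at)⁻¹ P(μ(t)x)` is jointly `Cⁿ` on `(0, ∞) × E` when `P ∈ Cⁿ`. [folklore] -/
theorem contDiffOn_uncurry_lerayForwardPressure (ha : 0 < a) {n : WithTop ℕ∞}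
    (hP : ContDiff ℝ n P) :
    ContDiffOn ℝ n (uncurry (lerayForwardPressure a P)) (Ioi 0 ×ˢ univ) := by
  have h2 : ContDiffOn ℝ n (fun z : ℝ × E => (2 * a * z.1)⁻¹) (Ioi 0 ×ˢ univ) :=
    (contDiff_const.mul contDiff_fst).contDiffOn.inv
      fun z hz => (lerayForwardScale_arg_pos ha hz.1).ne'
  have hL : ContDiffOn ℝ n (fun z : ℝ × E => (Real.sqrt (2 * a * z.1))⁻¹) (Ioi 0 ×ˢ univ) :=
    (contDiffOn_lerayForwardScale ha).comp contDiff_fst.contDiffOn fun z hz => hz.1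
  have hLx : ContDiffOn ℝ n (fun z : ℝ × E => (Real.sqrt (2 * a * z.1))⁻¹ • z.2)
      (Ioi 0 ×ˢ univ) := hL.smul contDiff_snd.contDiffOn
  exact h2.mul (hP.comp_contDiffOn hLx)

/-- **The forward reduction** (discharge of the named fact `lerayForward_isClassical_iff` of
`SelfSimilar.lean`; Jia–Šverák 2014, §1: the expanding self-similar solutions
`u(x, t) = t^{-1/2} U(x/√t)` and their profile system, here with general rate `a` and viscosity
`ν`; Lemarié-Rieusset 2016, §16.4). For `C^∞` profiles `U`, `P` and `0 < a`,
`(lerayForward a U, lerayForwardPressure a P)` is a classical unforced Navier–Stokes solution on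
`(0, ∞) × E` **iff** `(U, P)` solves the forward profile system `IsForwardProfile ν a U P`.
Backward implication: `IsForwardProfile.momentum_lerayForward`, `isDivFree_lerayForward` and the
joint smoothness lemmas, with `timeDerivWithin (Ioi 0) = timeDeriv` on the open time set; forward
implication: evaluate at `t₀ = (2a)⁻¹`, where `μ = 1`, `μ' = −a`, `u(t₀) = U`, `p(t₀) = P`.
(Leray 1934, §20 itself prints only the backward ansatz (3.12); the forward twin is its time
reflection `lerayBackward_eq_lerayForward`.) [cite: JiaSverak2014, §1] -/
theorem lerayForward_isClassical_iff_holds : lerayForward_isClassical_iff (E := E) := by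
  intro ν a ha U P hU hP
  have hU1 : ContDiff ℝ 1 U := hU.of_le (by norm_cast)
  constructor
  · -- classical solution ⟹ profile: evaluate at `t₀ = (2a)⁻¹`, where `μ = 1`
    intro h
    have ht₀ : (0 : ℝ) < (2 * a)⁻¹ := inv_pos.2 (by positivity)
    have hmem : (2 * a)⁻¹ ∈ Ioi (0 : ℝ) := ht₀
    have hint : (2 * a)⁻¹ ∈ interior (Ioi (0 : ℝ)) := by rwa [interior_Ioi]
    have hu₀ : lerayForward a U (2 * a)⁻¹ = U := lerayForward_apply_inv ha U
    have hp₀ : lerayForwardPressure a P (2 * a)⁻¹ = P := lerayForwardPressure_apply_inv ha P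
    refine ⟨hU.of_le (by norm_cast), hP.of_le (by norm_cast), fun y => ?_, fun y => ?_⟩
    · have hm := h.momentum _ hmem y
      rw [timeDerivWithin_of_mem_interior hint y, timeDeriv_lerayForward ha ht₀ hU1 y,
        lerayForwardScale_inv ha, hu₀, hp₀] at hm
      simp only [one_pow, mul_one, one_smul, Pi.zero_apply, add_zero] at hm
      calc -(ν • (Δ U) y) - a • U y - a • fderiv ℝ U y y + convect U U y + gradient P y
          = (-a • (U y + fderiv ℝ U y y) + convect U U y) - (ν • (Δ U) y - gradient P y) := by
            module
        _ = 0 := by rw [hm, sub_self]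
    · have hd := h.divFree _ hmem y
      rwa [hu₀] at hd
  · -- profile ⟹ classical solution on `(0, ∞) × E`
    intro h
    have hsu : IsSmoothSpaceTimeOn (Ioi 0) (lerayForward a U) :=
      contDiffOn_uncurry_lerayForward ha hU
    have hsp : IsSmoothSpaceTimeOn (Ioi 0) (lerayForwardPressure a P) :=
      contDiffOn_uncurry_lerayForwardPressure ha hP
    refine ⟨hsu, hsp, fun t ht x => ?_, fun t _ => isDivFree_lerayForward h.divFree a t⟩
    have ht' : 0 < t := ht
    have hint : t ∈ interior (Ioi (0 : ℝ)) := by rwa [interior_Ioi]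
    rw [timeDerivWithin_of_mem_interior hint x]
    exact h.momentum_lerayForward ha ht' x

end Forward

end Literature.Analysis.FluidPDE

end
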